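import Summits.NavierStokesRegularity.NavierStokesRegularity.Theorems.ScalingDefectPeepholeDoorPressureStein
import Literature.Analysis.FluidPDE.SereginSverakPressureProofs

/-!
# ScalingDefectPeepholeDoorPressureGauge — door S30 «ScalingDefectPeepholeDoor», plate P4 (frame) part 2, step 2:
# the GAUGE step and the ENERGY far field for `AnnularPressureBoundS30` (ns-s29-p2 g2)

* `weightedFar_le_of_energy` — the weighted far field of `abs_normalisedPressure_le_weighted_scale` is bounded by energy alone once
  the scale is fixed: `∫_{|y−x|>δ} |v|²/|x−y|³ ≤ δ⁻³ · 2E` when `∫|v|² ≤ 2E`.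
* `abs_le_of_ae_restrict_of_continuousOn` — an a.e. bound on an open set of times for a function continuous there holds everywhere.
* `abs_pressure_sub_le_of_normalisedPressure_le` — GAUGE: for a classical Leray–Hopf solution on `[0,T)` the pressure agrees
  a.e. in time with the normalised pressure up to a constant (`exists_pressure_gauge_of_classical`), so a bound `|p̃[u(t)]| ≤ B`
  on a set `A` for all `t ∈ (a,b) ⊆ (0,T)` gives `|p(t,x) − p(t,x₁)| ≤ 2B` for ALL `t ∈ (a,b)`, `x, x₁ ∈ A` (continuity of `p` in `t`).

Door S30 is a regularity CRITERION (item 0056 `NoTypeII` stays OPEN); nothing here bears on NS regularity itself.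
-/

noncomputable section

set_option linter.dupNamespace false

namespace Summit.NavierStokesRegularity.NavierStokesRegularity.Theorems.ScalingDefectPeepholeDoor

open MeasureTheory Set Function Filter Topology Metric
open scoped ENNReal
open Literature.Analysis Literature.Analysis.FluidPDE

/-! ## §1 The far field from the energy -/

/-- `∫_{|y−x|>δ} |v y|²/|x−y|³ ≤ (δ³)⁻¹ · 2E` for continuous `v` with `∫|v|² ≤ 2E`. -/
theorem weightedFar_le_of_energy {v : EuclideanSpace ℝ (Fin 3) → EuclideanSpace ℝ (Fin 3)} (hv : Continuous v)
    {E : ℝ} (hE0 : 0 ≤ E) (hE : (∫⁻ y, ‖v y‖ₑ ^ 2) ≤ ENNReal.ofReal (2 * E))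
    (x : EuclideanSpace ℝ (Fin 3)) {δ : ℝ} (hδ : 0 < δ) :
    ∫ y in (closedBall x δ)ᶜ, ‖v y‖ ^ 2 / ‖x - y‖ ^ 3 ≤ (δ ^ 3)⁻¹ * (2 * E) := by
  have hEt : (∫⁻ y, ‖v y‖ₑ ^ 2) < ⊤ := lt_of_le_of_lt hE ENNReal.ofReal_lt_top
  have hv2 : Integrable fun y => ‖v y‖ ^ 2 := integrable_sq_of_lintegral_enorm_sq_lt_top hv hEt
  -- `∫ |v|² ≤ 2E`
  have hint : ∫ y, ‖v y‖ ^ 2 ≤ 2 * E := by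
    have h1 : ∫⁻ y, ‖v y‖ₑ ^ 2 = ∫⁻ y, ENNReal.ofReal (‖v y‖ ^ 2) :=
      lintegral_congr fun y => by rw [← ofReal_norm, ENNReal.ofReal_pow (norm_nonneg _)]
    rw [integral_eq_lintegral_of_nonneg_ae (Eventually.of_forall fun y => sq_nonneg _)
      hv2.aestronglyMeasurable, ← h1]
    exact (ENNReal.toReal_le_toReal hEt.ne ENNReal.ofReal_ne_top).2 hE |>.trans
      (by rw [ENNReal.toReal_ofReal (by positivity)])
  have hcont : ContinuousOn (fun y => ‖v y‖ ^ 2 / ‖x - y‖ ^ 3) (closedBall x δ)ᶜ := by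
    refine (hv.norm.pow 2).continuousOn.div ((continuous_const.sub continuous_id).norm.pow 3).continuousOn
      fun y hy => ?_
    rw [mem_compl_iff, mem_closedBall, not_le, dist_comm, dist_eq_norm] at hy
    exact (pow_pos (hδ.trans hy) 3).ne'
  have hmaj : IntegrableOn (fun y => (δ ^ 3)⁻¹ * ‖v y‖ ^ 2) (closedBall x δ)ᶜ :=
    (hv2.const_mul _).integrableOn
  have hle : ∀ y ∈ (closedBall x δ)ᶜ, ‖v y‖ ^ 2 / ‖x - y‖ ^ 3 ≤ (δ ^ 3)⁻¹ * ‖v y‖ ^ 2 := by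
    intro y hy
    rw [mem_compl_iff, mem_closedBall, not_le, dist_comm, dist_eq_norm] at hy
    rw [div_eq_inv_mul]
    refine mul_le_mul_of_nonneg_right ?_ (sq_nonneg _)
    exact inv_anti₀ (pow_pos hδ 3) (pow_le_pow_left₀ hδ.le hy.le 3)
  have hint' : IntegrableOn (fun y => ‖v y‖ ^ 2 / ‖x - y‖ ^ 3) (closedBall x δ)ᶜ := by
    refine Integrable.mono' hmaj (hcont.aestronglyMeasurable measurableSet_closedBall.compl) ?_
    refine (ae_restrict_iff' measurableSet_closedBall.compl).2 (Eventually.of_forall fun y hy => ?_)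
    rw [Real.norm_eq_abs, abs_of_nonneg (by positivity)]
    exact hle y hy
  calc ∫ y in (closedBall x δ)ᶜ, ‖v y‖ ^ 2 / ‖x - y‖ ^ 3
      ≤ ∫ y in (closedBall x δ)ᶜ, (δ ^ 3)⁻¹ * ‖v y‖ ^ 2 :=
        setIntegral_mono_on hint' hmaj measurableSet_closedBall.compl hle
    _ = (δ ^ 3)⁻¹ * ∫ y in (closedBall x δ)ᶜ, ‖v y‖ ^ 2 := integral_const_mul _ _
    _ ≤ (δ ^ 3)⁻¹ * ∫ y, ‖v y‖ ^ 2 := by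
        refine mul_le_mul_of_nonneg_left ?_ (by positivity)
        exact setIntegral_le_integral hv2 (Eventually.of_forall fun y => sq_nonneg _)
    _ ≤ (δ ^ 3)⁻¹ * (2 * E) := mul_le_mul_of_nonneg_left hint (by positivity)

/-! ## §2 a.e. in time + continuity ⇒ every time -/

/-- If `g` is continuous on an open set `U ⊆ ℝ` and `|g t| ≤ B` for a.e. `t ∈ U`, then `|g t| ≤ B` for every `t ∈ U`. -/
theorem abs_le_of_ae_restrict_of_continuousOn {g : ℝ → ℝ} {U : Set ℝ} (hU : IsOpen U) (hg : ContinuousOn g U) {B : ℝ}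
    (h : ∀ᵐ t ∂(volume.restrict U), |g t| ≤ B) : ∀ t ∈ U, |g t| ≤ B := by
  -- `φ = max (|g| − B) 0` is continuous on `U` and vanishes a.e. there, hence everywhere on `U`
  set φ : ℝ → ℝ := fun t => max (|g t| - B) 0 with hφ
  have hφc : ContinuousOn φ U := by
    have h1 : ContinuousOn (fun t => |g t| - B) U := hg.abs.sub continuousOn_const
    have h2 : Continuous fun r : ℝ => max r 0 := continuous_id.max continuous_const
    exact h2.comp_continuousOn h1
  have hae : φ =ᵐ[volume.restrict U] fun _ => 0 := by
    filter_upwards [h] with t ht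
    simp only [hφ, max_eq_right_iff]
    linarith
  have heq := Measure.eqOn_open_of_ae_eq hae hU hφc continuousOn_const
  intro t ht
  have h1 : φ t = 0 := heq ht
  have h2 : max (|g t| - B) 0 = 0 := h1
  have h3 : |g t| - B ≤ max (|g t| - B) 0 := le_max_left _ _
  linarith

/-! ## §3 The gauge step -/

section Gauge

variable {ν T : ℝ} {u : ℝ → EuclideanSpace ℝ (Fin 3) → EuclideanSpace ℝ (Fin 3)} {p : ℝ → EuclideanSpace ℝ (Fin 3) → ℝ}

/-- continuity of `t ↦ p t x` on the time set of a classical solution. -/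
theorem continuousOn_pressure_time (hsol : IsClassicalNSSolutionOn (Ico 0 T) ν 0 u p) (x : EuclideanSpace ℝ (Fin 3)) :
    ContinuousOn (fun t => p t x) (Ico 0 T) := by
  have h1 : ContinuousOn (uncurry p) (Ico 0 T ×ˢ univ) := hsol.smooth_pressure.continuousOn
  have h2 : ContinuousOn (fun t : ℝ => (t, x)) (Ico 0 T) := (continuous_id.prodMk continuous_const).continuousOn
  have h3 : MapsTo (fun t : ℝ => (t, x)) (Ico 0 T) (Ico 0 T ×ˢ univ) := fun t ht => ⟨ht, mem_univ _⟩
  have h := h1.comp h2 h3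
  exact h

/-- **Gauge step.**  For a classical Leray–Hopf solution on `[0,T)`: if `|p̃[u(t)](x)| ≤ B` for all `t ∈ (a,b) ⊆ (0,T)` and all
`x ∈ A`, then `|p(t,x) − p(t,x₁)| ≤ 2B` for ALL `t ∈ (a,b)` and `x, x₁ ∈ A`. -/
theorem abs_pressure_sub_le_of_normalisedPressure_le (hν : 0 < ν) (hT : 0 < T)
    (hsol : IsClassicalNSSolutionOn (Ico 0 T) ν 0 u p) (hLH : IsLerayHopfOn T ν 0 (u 0) u)
    {a b : ℝ} (ha : 0 ≤ a) (hb : b ≤ T) {A : Set (EuclideanSpace ℝ (Fin 3))} {B : ℝ}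
    (hB : ∀ t ∈ Ioo a b, ∀ x ∈ A, |normalisedPressure (u t) x| ≤ B) :
    ∀ t ∈ Ioo a b, ∀ x ∈ A, ∀ x₁ ∈ A, |p t x - p t x₁| ≤ 2 * B := by
  intro t ht x hx x₁ hx₁
  have hsub : Ioo a b ⊆ Ico 0 T := fun s hs => ⟨ha.trans hs.1.le, hs.2.trans_le hb⟩
  have hsub' : Ioo a b ⊆ Ioo 0 T := fun s hs => ⟨ha.trans_lt hs.1, hs.2.trans_le hb⟩
  have hg : ContinuousOn (fun s => p s x - p s x₁) (Ioo a b) :=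
    ((continuousOn_pressure_time hsol x).mono hsub).sub ((continuousOn_pressure_time hsol x₁).mono hsub)
  refine abs_le_of_ae_restrict_of_continuousOn isOpen_Ioo hg ?_ t ht
  have hgauge := (SereginSverak2002.exists_pressure_gauge_of_classical hν hT hsol hLH).1
  have hgauge' : ∀ᵐ s ∂(volume.restrict (Ioo a b)), ∀ y,
      p s y - (p s 0 - normalisedPressure (u s) 0) = normalisedPressure (u s) y :=
    ae_restrict_of_ae_restrict_of_subset hsub' hgauge
  filter_upwards [hgauge', ae_restrict_mem measurableSet_Ioo] with s hs hsI
  have h1 : p s x - p s x₁ = normalisedPressure (u s) x - normalisedPressure (u s) x₁ := by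
    have ex := hs x
    have ex₁ := hs x₁
    linarith
  rw [h1]
  calc |normalisedPressure (u s) x - normalisedPressure (u s) x₁|
      ≤ |normalisedPressure (u s) x| + |normalisedPressure (u s) x₁| := abs_sub _ _
    _ ≤ B + B := add_le_add (hB s hsI x hx) (hB s hsI x₁ hx₁)
    _ = 2 * B := by ring

end Gauge

end Summit.NavierStokesRegularity.NavierStokesRegularity.Theorems.ScalingDefectPeepholeDoor

end
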